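import Literature.AlgebraicGeometry.Frobenioids.ModelFrobenioidPreFrobenioid
import Literature.AnabelianGeometry.EtaleTheta.TemperedFrobenioidToy

/-!
# [EtTh] Def 3.1 (i)(ii) / Def 3.3 (iii): divisors of constants are non-cuspidal — the named datum

S. Mochizuki, *The étale theta function …*, Publ. RIMS **45** (2009) [MochizukiEtTh2009], Def 3.1 (i)(ii)
p.70 ("non-cuspidal … whose support lies in the special fiber"; "constant log-meromorphic functions …
arising from `L^×`") and Def 3.3 (iii) p.73 (`F₀ ⊆ B₀`, `Φ₀^cnst` = image of `F₀` in `Φ₀^gp`).  In print the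
log-divisor of a constant `c ∈ L^×` is `v(c)`·(special fibre), hence a difference of NON-CUSPIDAL effective
log-divisors.  The statement file `DivisorMonoids.lean` (abc-iut-L2-t3) carries `F₀`, `div₀`, `ncsp₀` as
data but does not record this relation; the discharge of Cor 3.8 (iii) (abc-iut-L2-d2, `cor38_iii_of`,
binder `hD1`) needs it.  Rather than a new FIELD (the structure now has constructors in the tree —
`Toy.divisorMonoids`; `RealifiedDivisorMonoids.ofRlfZ` consumes it), the relation is named here as a
PREDICATE on the data, `DivisorMonoids.CnstNonCuspidal`, to be supplied by constructions and assumed by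
name by discharges; the toy datum satisfies it (`Toy.cnstNonCuspidal`).  Owner file (gen 2).
HONEST FRAMING: a definition + a consistency instance; nothing of [EtTh] is asserted; nothing here bears
on [IUTchIII] Cor. 3.12.
-/

namespace Literature.AnabelianGeometry.EtaleTheta

open CategoryTheory Opposite Literature.AlgebraicGeometry.Frobenioids

universe u v w

/-- **"Divisors of constants are non-cuspidal"** (Def 3.1 (i)(ii), p.70; Def 3.3 (iii), p.73): for every
constant log-meromorphic function `b ∈ F₀(Y)`, its log-divisor `div₀(b) ∈ Φ₀(Y)^gp` is a quotient
`n₁ / n₂` of non-cuspidal elements `n₁, n₂ ∈ Φ₀(Y)^ncsp` (in print: `± v(b)` times the special fibre).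
A predicate on the Def 3.3 (iii) data (the binder `hD1` of the Cor 3.8 (iii) discharge at the `Φ₀` level).
[cite: MochizukiEtTh2009, Def 3.1 p.70] -/
def DivisorMonoids.CnstNonCuspidal {D₀ : Type u} [Category.{v} D₀] (dm : DivisorMonoids.{u, v, w} D₀) :
    Prop :=
  ∀ (Y : D₀ᵒᵖ) (b : dm.B₀.obj Y), b ∈ dm.F₀ Y →
    ∃ n₁ ∈ dm.ncsp₀ Y, ∃ n₂ ∈ dm.ncsp₀ Y,
      dm.div₀ Y b * Algebra.GrothendieckGroup.of n₂ = Algebra.GrothendieckGroup.of n₁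

/-- The toy datum satisfies it (everything is non-cuspidal there): consistency of the predicate with the
interface stack. [cite: MochizukiEtTh2009, Def 3.1 p.70] -/
theorem Toy.cnstNonCuspidal : Toy.divisorMonoids.CnstNonCuspidal := by
  intro Y b _
  -- `div₀ b ∈ ℕ^gp` is a fraction of two elements of `ℕ = Φ₀(Y)^ncsp`
  obtain ⟨n₁, n₂, h⟩ := gp_exists_mul_of_eq_of (Toy.divisorMonoids.div₀ Y b)
  exact ⟨n₁, trivial, n₂, trivial, h⟩

end Literature.AnabelianGeometry.EtaleTheta
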